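import Summits.CriticalPhenomena.PercolationContinuityZ3.Theorems.PercNearOneGluingNoHeavyLowerTailSahiCoordinateAntitone
import Summits.CriticalPhenomena.PercolationContinuityZ3.Theorems.PercNearOneGluingNoHeavyLowerTailSahiCombMixFourSingleOne
import Summits.CriticalPhenomena.PercolationContinuityZ3.Theorems.PercNearOneGluingNoHeavyLowerTailSahiCombDisjunctThreeIdentities
import Mathlib.Tactic.Linarith
import Mathlib.Tactic.Ring
import HarnessLib

/-!
# `NoHeavyLowerTail` (crux stmt-CriticalPhenomena-4575), master-family line P2: the antitone master form (MT-k) is a THEOREM at order `k = 2`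

Support file (seat `prim-masterthm-p2`, gen 12; `--supports stmt-CriticalPhenomena-4575`); no new definition, no sorry.  Memo SAHI-ROUTE.md §4.35(d).

`SahiCoordinateAntitone.MasterAntitone k` (p289656) says that `p ↦ E_k(μ_p; 1_U)/∏_e p_e` is order-reversing for increasing `U`.  Here we PROVE the case `k = 2`
(`masterAntitone_two`; reusing `SahiCombMix.secAt_univ'`, `SahiCombDisjunct.ex_ind_univ`): for increasing events `A, B` and `p ≤ p′`, `Cov_{p′}(A,B)·∏ p_e ≤ Cov_p(A,B)·∏ p′_e`.  Proof: `E_2(A,B) = E_3(Ω, A, B)` (branching with the sure event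
[Sahi2008, Thm. 6]); for the triple `(Ω, A, B)` the two-thirds quantity at a coordinate `e` is `coordPiece₂ + E_3(Ω, A⁰, B⁰) = ν_A ν_B + Cov(A⁰, B⁰) ≥ 0` (closed form of the
Bernstein piece, `SahiCoordinateChord.coordPiece₂_eq`, and Harris on the sections), so the one-coordinate step of p289656 (re-stated with explicit pointwise hypotheses,
`sahiE_three_update_antitone_of`) applies, and the coordinates are changed one at a time.  Axioms standard. [this work]
-/

noncomputable section

open scoped Classical

namespace Summit.CriticalPhenomena.PercolationContinuityZ3.Theorems

namespace SahiCoordinateAntitone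

open Finset Function
open Literature.Combinatorics.Sahi2008
open Literature.Probability.Percolation.DecisionTree (ind ind_of_mem ind_of_not_mem ind_nonneg)
open SahiCoordinateBernstein (coordPiece₁ coordPiece₂ sahiE_three_decomp_coord)
open SahiCoordinateTwoThirds (coordPiece₂_le_coordPiece₁ ind_secAt_vec3)

variable {ι : Type} [Fintype ι]

/-! ### 1. The one-coordinate step with explicit pointwise hypotheses -/

/-- **ONE COORDINATE, pointwise hypotheses**: if the `0`-sections at `e` have `E_3 ≥ 0` and the two-thirds quantity at `e` is `≥ 0`, then raising `p_e` from `s` to `s'`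
can only lower `E_3/p_e`. (Same proof as `sahiE_three_update_antitone`, with (T3∀) replaced by its two pointwise consequences.) [this work] -/
theorem sahiE_three_update_antitone_of (p : ι → unitInterval) (e : ι) {A B C : Set (Set ι)}
    (hA : IsUpperSet A) (hB : IsUpperSet B) (hC : IsUpperSet C) {s s' : unitInterval} (hss : s ≤ s')
    (hE0 : 0 ≤ sahiE (bernoulliWeight (update p e s)) 3
      (fun j => ind (secAt e false ((![A, B, C] : Fin 3 → Set (Set ι)) j))))
    (hT3 : 0 ≤ coordPiece₂ p e ![A, B, C] + sahiE (bernoulliWeight (update p e s)) 3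
      (fun j => ind (secAt e false ((![A, B, C] : Fin 3 → Set (Set ι)) j)))) :
    sahiE (bernoulliWeight (update p e s')) 3 ![ind A, ind B, ind C] * (s : ℝ) ≤
      sahiE (bernoulliWeight (update p e s)) 3 ![ind A, ind B, ind C] * (s' : ℝ) := by
  have hdec : ∀ σ : unitInterval,
      sahiE (bernoulliWeight (update p e σ)) 3 ![ind A, ind B, ind C] =
        (1 - (σ : ℝ)) * sahiE (bernoulliWeight (update p e σ)) 3 (fun j => ind (secAt e false ((![A, B, C] : Fin 3 → Set (Set ι)) j)))
        + (σ : ℝ) * sahiE (bernoulliWeight (update p e σ)) 3 (fun j => ind (secAt e true ((![A, B, C] : Fin 3 → Set (Set ι)) j)))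
        + (σ : ℝ) * (1 - (σ : ℝ)) * ((1 - (σ : ℝ)) * coordPiece₁ p e ![A, B, C] + (σ : ℝ) * coordPiece₂ p e ![A, B, C]) := by
    intro σ
    have h := sahiE_three_decomp_coord (update p e σ) e ![A, B, C]
    rw [Pointwise.ind_vec3, update_self, SahiCoordinateChord.coordPiece₁_update_same,
      SahiCoordinateChord.coordPiece₂_update_same] at h
    exact h
  have h0 := sahiE_three_secAt_update p e false s' s ![A, B, C]
  have h1 := sahiE_three_secAt_update p e true s' s ![A, B, C]
  have hb := coordPiece₂_le_coordPiece₁ p e hA hB hC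
  rw [hdec s', hdec s, h0, h1]
  exact antitone_core hE0 hT3 hb (s).2.1 hss (s').2.2

/-! ### 2. The sure event as a member: `E_2(A,B) = E_3(Ω,A,B)` and its two-thirds quantity -/

/-- **Branching with the sure event**: `E_3(Ω, A, B) = E_2(A, B)` under a product weight. [cite: Sahi2008, Thm. 6 (p. 214)] -/
theorem sahiE_three_univ (p : ι → unitInterval) (A B : Set (Set ι)) :
    sahiE (bernoulliWeight p) 3 ![ind (Set.univ : Set (Set ι)), ind A, ind B] = sahiE (bernoulliWeight p) 2 ![ind A, ind B] := by
  rw [ind_univ_eq_one]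
  have h := sahiE_one_cons (sum_bernoulliWeight p) 1 ![ind A, ind B]
  rw [Nat.cast_one, one_mul] at h
  exact h

/-- **The two-thirds quantity of `(Ω, A, B)` at a coordinate**: `coordPiece₂ + E_3(Ω, A⁰, B⁰) = ν_A ν_B + Cov(A⁰, B⁰) ≥ 0` for increasing `A, B`
(closed form of the piece + Harris on the sections). [this work] -/
theorem twoThirds_univ (p : ι → unitInterval) (e : ι) {A B : Set (Set ι)} (hA : IsUpperSet A) (hB : IsUpperSet B) :
    0 ≤ coordPiece₂ p e ![Set.univ, A, B] +
      sahiE (bernoulliWeight p) 3 (fun j => ind (secAt e false ((![Set.univ, A, B] : Fin 3 → Set (Set ι)) j))) := by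
  -- the piece in closed form
  have hpiece := SahiCoordinateChord.coordPiece₂_eq p e (Set.univ : Set (Set ι)) A B
  simp only [SahiCombMix.secAt_univ', Set.univ_inter, SahiCombDisjunct.ex_ind_univ, sub_self, zero_mul, mul_zero, zero_add, add_zero, one_mul, sub_zero] at hpiece
  -- `E_3` of the sections is `Cov(A⁰, B⁰) ≥ 0`
  have hsec : sahiE (bernoulliWeight p) 3 (fun j => ind (secAt e false ((![Set.univ, A, B] : Fin 3 → Set (Set ι)) j))) =
      sahiE (bernoulliWeight p) 2 ![ind (secAt e false A), ind (secAt e false B)] := by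
    rw [ind_secAt_vec3, SahiCombMix.secAt_univ', sahiE_three_univ]
  have hcov : 0 ≤ sahiE (bernoulliWeight p) 2 ![ind (secAt e false A), ind (secAt e false B)] := by
    have h2 := masterFamilyNonneg_of_le_two (le_refl 2) ι p ![secAt e false A, secAt e false B]
      (fun j => by fin_cases j <;> simpa using isUpperSet_secAt e false (by assumption))
    have hfun : (fun j => ind ((![secAt e false A, secAt e false B] : Fin 2 → Set (Set ι)) j)) =
        ![ind (secAt e false A), ind (secAt e false B)] := by
      funext j; fin_cases j <;> rfl
    rw [hfun] at h2
    exact h2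
  have nA := Pointwise.ex_secAt_true_sub_false_nonneg p e hA
  have nB := Pointwise.ex_secAt_true_sub_false_nonneg p e hB
  rw [hsec, hpiece]
  nlinarith [mul_nonneg nA nB]

/-! ### 3. (MT-2) is a theorem -/

/-- **ONE COORDINATE at order two**: for increasing `A, B`, raising `p_e` from `s` to `s'` can only lower `Cov_p(A,B)/p_e`. [this work] -/
theorem sahiE_two_update_antitone (p : ι → unitInterval) (e : ι) {A B : Set (Set ι)} (hA : IsUpperSet A) (hB : IsUpperSet B)
    {s s' : unitInterval} (hss : s ≤ s') :
    sahiE (bernoulliWeight (update p e s')) 2 ![ind A, ind B] * (s : ℝ) ≤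
      sahiE (bernoulliWeight (update p e s)) 2 ![ind A, ind B] * (s' : ℝ) := by
  rw [← sahiE_three_univ (update p e s'), ← sahiE_three_univ (update p e s)]
  have hT3 := twoThirds_univ (update p e s) e hA hB
  rw [SahiCoordinateChord.coordPiece₂_update_same] at hT3
  have hE0 : 0 ≤ sahiE (bernoulliWeight (update p e s)) 3
      (fun j => ind (secAt e false ((![Set.univ, A, B] : Fin 3 → Set (Set ι)) j))) := by
    rw [ind_secAt_vec3, SahiCombMix.secAt_univ', sahiE_three_univ]
    have h2 := masterFamilyNonneg_of_le_two (le_refl 2) ι (update p e s) ![secAt e false A, secAt e false B]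
      (fun j => by fin_cases j <;> simpa using isUpperSet_secAt e false (by assumption))
    have hfun : (fun j => ind ((![secAt e false A, secAt e false B] : Fin 2 → Set (Set ι)) j)) =
        ![ind (secAt e false A), ind (secAt e false B)] := by
      funext j; fin_cases j <;> rfl
    rw [hfun] at h2
    exact h2
  exact sahiE_three_update_antitone_of p e isUpperSet_univ hA hB hss hE0 hT3

/-- **(MT-2) HOLDS**: for increasing `A, B` and `p ≤ p'`, `E_2(μ_{p'}; 1_A, 1_B)·∏ p_e ≤ E_2(μ_p; 1_A, 1_B)·∏ p'_e` — the order-two case of the antitone master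
form is a theorem (Harris on sections). [this work] -/
theorem masterAntitone_two : MasterAntitone 2 := by
  intro κ _ p p' U hU hpp'
  have hUeq : (fun j => ind (U j)) = ![ind (U 0), ind (U 1)] := by
    funext j; fin_cases j <;> rfl
  rw [hUeq]
  suffices h : ∀ S : Finset κ,
      sahiE (bernoulliWeight (fun e => if e ∈ S then p' e else p e)) 2 ![ind (U 0), ind (U 1)] * ∏ e ∈ S, (p e : ℝ) ≤
        sahiE (bernoulliWeight p) 2 ![ind (U 0), ind (U 1)] * ∏ e ∈ S, (p' e : ℝ) by
    have hu := h Finset.univ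
    simp only [Finset.mem_univ, if_true] at hu
    exact hu
  intro S
  induction S using Finset.induction_on with
  | empty => simp
  | insert a S haS ih =>
    set q : κ → unitInterval := fun e => if e ∈ S then p' e else p e with hq
    have hq' : (fun e => if e ∈ insert a S then p' e else p e) = update q a (p' a) := by
      funext e
      by_cases hea : e = a
      · subst hea
        rw [update_self, if_pos (Finset.mem_insert_self e S)]
      · rw [update_of_ne hea]
        simp only [hq, Finset.mem_insert, hea, false_or]
    have hqa : update q a (p a) = q := by
      funext e
      by_cases hea : e = a
      · subst hea
        rw [update_self]
        simp only [hq, if_neg haS]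
      · rw [update_of_ne hea]
    rw [hq', Finset.prod_insert haS, Finset.prod_insert haS]
    have step := sahiE_two_update_antitone q a (hU 0) (hU 1) (hpp' a)
    rw [hqa] at step
    have hprod : 0 ≤ ∏ e ∈ S, (p e : ℝ) := Finset.prod_nonneg fun e _ => (p e).2.1
    have hpa' : 0 ≤ (p' a : ℝ) := (p' a).2.1
    calc sahiE (bernoulliWeight (update q a (p' a))) 2 ![ind (U 0), ind (U 1)] * ((p a : ℝ) * ∏ e ∈ S, (p e : ℝ))
        = (sahiE (bernoulliWeight (update q a (p' a))) 2 ![ind (U 0), ind (U 1)] * (p a : ℝ)) * ∏ e ∈ S, (p e : ℝ) := by ring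
      _ ≤ (sahiE (bernoulliWeight q) 2 ![ind (U 0), ind (U 1)] * (p' a : ℝ)) * ∏ e ∈ S, (p e : ℝ) :=
          mul_le_mul_of_nonneg_right step hprod
      _ = (sahiE (bernoulliWeight q) 2 ![ind (U 0), ind (U 1)] * ∏ e ∈ S, (p e : ℝ)) * (p' a : ℝ) := by ring
      _ ≤ (sahiE (bernoulliWeight p) 2 ![ind (U 0), ind (U 1)] * ∏ e ∈ S, (p' e : ℝ)) * (p' a : ℝ) :=
          mul_le_mul_of_nonneg_right ih hpa'
      _ = sahiE (bernoulliWeight p) 2 ![ind (U 0), ind (U 1)] * ((p' a : ℝ) * ∏ e ∈ S, (p' e : ℝ)) := by ring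

end SahiCoordinateAntitone

end Summit.CriticalPhenomena.PercolationContinuityZ3.Theorems
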